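import Summits.ValiantsHypothesis.ValiantsHypothesis.Theorems.LacunarySymmetroidMatrixDescartesPivotTwoDirections
import Summits.ValiantsHypothesis.ValiantsHypothesis.Theorems.LacunarySymmetroidMatrixDescartesCensusDoorA34StrataExact
import Summits.ValiantsHypothesis.ValiantsHypothesis.Theorems.LacunarySymmetroidMatrixDescartesCensusFullAlternation

/-!
# `MatrixDescartes` census — THE RANK-ONE `(2,3)₁` CELL IS ODD: `Z₊ ≤ 5`, and `5` is attained
# (Descartes plus parity of the sign variations; an exact integer object)

HONEST FRAMING.  Object-search cell `pub-symmetroid`, seat `val-sym-mdr-p1` (generation 13); helper file `--supports` the crux item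
stmt-ValiantsHypothesis-18050 (`Theses.LacunarySymmetroid.MatrixDescartes`, OPEN, on HOLD) with NO closure claim.  A datum for the `m = 2`
pivot column (conjb-1 currency `…CensusPivotDefs`): the row value at `K = 3` is `6 = 2K` (`…PivotTwoThree`, rank-two letters); THIS FILE:
with RANK-ONE letters the value drops to FIVE.  Companion of `…PivotRankOneEight` (rank-one `(2,4)₁` reaches `8 = 2K`: at `K = 4` the
rank-one sub-row catches up) and of g12's `…PivotTwoDirectionsSharp` (two PARALLEL letters below against one above: exactly `4`).

* `det_rankOne_three_sum` — the determinant of `X^e J + ∑ₖ wₖX^{dₖ} vₖvₖᵀ` (`k = 0,1,2`) as a seven-nomial on the degrees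
  `2e, e+dₖ` (coefficients `det J`, `wₖ m(J,vₖ)`) and `dₖ+dₗ` (coefficients `wₖwₗΔₖₗ² ≥ 0`).
* `signVariations_sevenNomial_le_five` — PARITY STEP: a seven-nomial whose lowest and highest coefficients have opposite signs has
  `Var ≤ 5` (`Var < 7`, Literature `signVariations_lt_card_support`, and `Var` odd, Literature `even_signVariations_iff` after factoring
  `X^{n₀}`).
* **`rankOne_posRoots_le_five_twoOne`** (`d₀ < d₁ < e < d₂`, the above-pivot letter core, `J` any real `2 × 2`, `wₖ ≥ 0`) and
  **`rankOne_posRoots_le_five_oneTwo`** (`d₀ < e < d₁ < d₂`, the below-pivot letter core): **`Z₊ ≤ 5`**.  Ends: in the first split the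
  lowest coefficient is `w₀w₁Δ₀₁² ≥ 0` and the highest `w₂m(J,v₂) < 0` — if the former vanishes there are six terms, otherwise `Var` is
  odd; mirror in the second.
* **`object_pivotPosRoots_eq_five`** — pivot `[[0,10⁶],[10⁶,0]]` at `e = 3` (index one), letters `(1,1)(1,1)ᵀ`, `130·(1,7)(1,7)ᵀ`,
  `60·(1,22000)(1,22000)ᵀ` at `0, 2, 5` (all core): `det F = 4680x² − 2·10⁶x³ + 27217360060x⁵ − 10¹²x⁶ + 3772797982200x⁷ − 2.64·10¹²x⁸`
  (`V = 5`; the resonance `3 + 2 = 0 + 5` merges two terms), alternating `+ − + − + −` at `x = 1/1000, 1/200, 1/50, 1/10, 1/2, 2`: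
  EXACTLY `5`; `exists_rankOne_three_five`.  Located mechanism (seat, hub floats): split the parallel pair of g12's exact-`4` object —
  one far-out crossing appears (`4 + 1`), as `6 + 2` gives the rank-one EIGHT at `K = 4`.
So the rank-one sub-row of the pivot column reads `2, 5, ≥ 8` at `K = 2, 3, 4` (general letters `4, 6, ≥ 8`).  Nothing here bears on
`MatrixDescartes` in its window, on `DoorA26` / `DoorA34`, registers / credences, or `VP ≠ VNP`.

[folklore] Descartes' rule of signs with parity; IVT certificate via `Pivot.le_pivotPosRoots_of_certificate`; tree lemmas named above.
No definitions, no named facts.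
-/

-- `Summit.ValiantsHypothesis.ValiantsHypothesis.…` repeats a component by the D-0017 layout
-- (single-conjunct summit), which the `dupNamespace` linter flags; the name is mandated.
set_option linter.dupNamespace false

namespace Summit.ValiantsHypothesis.ValiantsHypothesis.Theorems.LacunarySymmetroidMatrixDescartes.Pivot.RankOneThree

open Polynomial Matrix Finset
open scoped BigOperators

/-! ## 1. The seven-nomial of a `2 × 2` pivot pencil with THREE rank-one letters -/

/-- `det (X^e J + ∑ₖ wₖ X^{dₖ} vₖvₖᵀ)` (`k = 0,1,2`) as a `Fin 7`-indexed fewnomial on the degrees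
`(2e, e+d₀, e+d₁, e+d₂, d₀+d₁, d₀+d₂, d₁+d₂)` with coefficients `(det J, wₖ·m(J,vₖ), wₖwₗ·Δₖₗ²)`. [folklore] -/
theorem det_rankOne_three_sum (e d₀ d₁ d₂ : ℕ) (J : Matrix (Fin 2) (Fin 2) ℝ) (v₀ v₁ v₂ : Fin 2 → ℝ) (w₀ w₁ w₂ : ℝ) :
    Matrix.det (((X : ℝ[X]) ^ e) • J.map Polynomial.C
        + (Polynomial.C w₀ * X ^ d₀) • (vecMulVec v₀ v₀).map Polynomial.C
        + (Polynomial.C w₁ * X ^ d₁) • (vecMulVec v₁ v₁).map Polynomial.C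
        + (Polynomial.C w₂ * X ^ d₂) • (vecMulVec v₂ v₂).map Polynomial.C)
      = ∑ i : Fin 7, Polynomial.C ((![J.det,
          w₀ * (J 0 0 * v₀ 1 ^ 2 + J 1 1 * v₀ 0 ^ 2 - (J 0 1 + J 1 0) * (v₀ 0 * v₀ 1)),
          w₁ * (J 0 0 * v₁ 1 ^ 2 + J 1 1 * v₁ 0 ^ 2 - (J 0 1 + J 1 0) * (v₁ 0 * v₁ 1)),
          w₂ * (J 0 0 * v₂ 1 ^ 2 + J 1 1 * v₂ 0 ^ 2 - (J 0 1 + J 1 0) * (v₂ 0 * v₂ 1)),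
          w₀ * w₁ * ((v₀ 0 * v₁ 1 - v₀ 1 * v₁ 0) ^ 2), w₀ * w₂ * ((v₀ 0 * v₂ 1 - v₀ 1 * v₂ 0) ^ 2),
          w₁ * w₂ * ((v₁ 0 * v₂ 1 - v₁ 1 * v₂ 0) ^ 2)] : Fin 7 → ℝ) i)
          * X ^ ((![2 * e, e + d₀, e + d₁, e + d₂, d₀ + d₁, d₀ + d₂, d₁ + d₂] : Fin 7 → ℕ) i) := by
  rw [Matrix.det_fin_two, Matrix.det_fin_two]
  simp only [Matrix.add_apply, Matrix.smul_apply, Matrix.map_apply, Matrix.vecMulVec_apply, smul_eq_mul,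
    Polynomial.C_mul, Polynomial.C_sub, Polynomial.C_add, Polynomial.C_pow, Fin.sum_univ_succ, Fin.sum_univ_zero,
    Matrix.cons_val_zero, Matrix.cons_val_succ]
  simp
  ring

/-- Coefficients of the seven-nomial. -/
theorem coeff_sevenNomial (e d₀ d₁ d₂ : ℕ) (cv : Fin 7 → ℝ) (m : ℕ) :
    (∑ i : Fin 7, Polynomial.C (cv i) * X ^ ((![2 * e, e + d₀, e + d₁, e + d₂, d₀ + d₁, d₀ + d₂, d₁ + d₂] : Fin 7 → ℕ) i)).coeff m
      = ∑ i : Fin 7, (if m = (![2 * e, e + d₀, e + d₁, e + d₂, d₀ + d₁, d₀ + d₂, d₁ + d₂] : Fin 7 → ℕ) i then cv i else 0) := by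
  rw [finsetSum_coeff]
  simp only [coeff_C_mul_X_pow]

/-- A `Fin 7`-indexed fewnomial is `X^n₀` times the fewnomial with exponents lowered by `n₀`, when all exponents are `≥ n₀`. [folklore] -/
theorem sevenNomial_eq_X_pow_mul (cv : Fin 7 → ℝ) (nv : Fin 7 → ℕ) (n₀ : ℕ) (h : ∀ i, n₀ ≤ nv i) :
    (∑ i : Fin 7, Polynomial.C (cv i) * X ^ (nv i)) = X ^ n₀ * ∑ i : Fin 7, Polynomial.C (cv i) * X ^ (nv i - n₀) := by
  rw [Finset.mul_sum]
  refine Finset.sum_congr rfl fun i _ => ?_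
  rw [← mul_assoc, mul_comm (X ^ n₀) (Polynomial.C (cv i)), mul_assoc, ← pow_add, Nat.add_sub_cancel' (h i)]

/-- **Parity step.**  A `Fin 7`-indexed fewnomial whose lowest exponent `nv i₀` is attained only at `i₀` and whose highest `nv i₁` only
at `i₁`, with `cv i₀ · cv i₁ < 0` (ends of opposite sign): `Var ≤ 5` (`Var < 7` and `Var` odd). [folklore] -/
theorem signVariations_sevenNomial_le_five (cv : Fin 7 → ℝ) (nv : Fin 7 → ℕ) (i₀ i₁ : Fin 7)
    (hlo : ∀ i, i ≠ i₀ → nv i₀ < nv i) (hhi : ∀ i, i ≠ i₁ → nv i < nv i₁) (hends : cv i₀ * cv i₁ < 0) :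
    (∑ i : Fin 7, Polynomial.C (cv i) * X ^ (nv i)).signVariations ≤ 5 := by
  classical
  have h01 : i₀ ≠ i₁ := by
    intro h; rw [h] at hends; exact absurd hends (not_lt.mpr (mul_self_nonneg _))
  have hc₀ : cv i₀ ≠ 0 := fun h => by rw [h, zero_mul] at hends; exact lt_irrefl _ hends
  have hc₁ : cv i₁ ≠ 0 := fun h => by rw [h, mul_zero] at hends; exact lt_irrefl _ hends
  set n₀ := nv i₀ with hn₀
  have hle : ∀ i, n₀ ≤ nv i := fun i => by
    by_cases h : i = i₀
    · rw [h]
    · exact (hlo i h).le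
  set g := ∑ i : Fin 7, Polynomial.C (cv i) * X ^ (nv i - n₀) with hg
  have hfg : (∑ i : Fin 7, Polynomial.C (cv i) * X ^ (nv i)) = X ^ n₀ * g := sevenNomial_eq_X_pow_mul cv nv n₀ hle
  rw [hfg, Literature.Algebra.Polynomial.Descartes.signVariations_X_pow_mul]
  have hgc : ∀ m, g.coeff m = ∑ i : Fin 7, (if m = nv i - n₀ then cv i else 0) := fun m => by
    rw [hg, finsetSum_coeff]; simp only [coeff_C_mul_X_pow]
  -- constant coefficient
  have hg0 : g.coeff 0 = cv i₀ := by
    rw [hgc, Finset.sum_eq_single i₀]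
    · rw [if_pos (by omega)]
    · intro i _ hi
      have := hlo i hi
      rw [if_neg (by omega)]
    · intro h; exact absurd (Finset.mem_univ _) h
  -- leading coefficient
  have hgtop : g.coeff (nv i₁ - n₀) = cv i₁ := by
    rw [hgc, Finset.sum_eq_single i₁]
    · rw [if_pos rfl]
    · intro i _ hi
      have := hhi i hi
      have := hle i
      rw [if_neg (by omega)]
    · intro h; exact absurd (Finset.mem_univ _) h
  have hdeg_le : g.natDegree ≤ nv i₁ - n₀ := by
    rw [hg]
    refine natDegree_sum_le_of_forall_le _ _ fun i _ => (natDegree_C_mul_X_pow_le _ _).trans ?_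
    by_cases h : i = i₁
    · rw [h]
    · have := hhi i h; omega
  have hdeg : g.natDegree = nv i₁ - n₀ := natDegree_eq_of_le_of_coeff_ne_zero hdeg_le (by rw [hgtop]; exact hc₁)
  have hlead : g.leadingCoeff = cv i₁ := by
    change g.coeff g.natDegree = cv i₁; rw [hdeg, hgtop]
  have hgne : g ≠ 0 := fun h => by
    have := hg0; rw [h, coeff_zero] at this; exact hc₀ this.symm
  -- `Var(g) < #supp g ≤ 7`
  have hV7 : g.signVariations < 7 := by
    have h1 := Literature.Computability.AlgebraicComplexity.signVariations_lt_card_support hgne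
    have h2 : g.support.card ≤ 7 := by
      have hsub : g.support ⊆ (Finset.univ : Finset (Fin 7)).image (fun i => nv i - n₀) := by
        intro m hm
        rw [Polynomial.mem_support_iff, hgc] at hm
        obtain ⟨i, _, hi⟩ := Finset.exists_ne_zero_of_sum_ne_zero hm
        refine Finset.mem_image.mpr ⟨i, Finset.mem_univ _, ?_⟩
        by_contra hne
        exact hi (if_neg (fun h => hne h.symm))
      exact (Finset.card_le_card hsub).trans (Finset.card_image_le.trans (by simp))
    omega
  -- parity: `Var(g)` is odd
  have hodd : ¬ Even g.signVariations := by
    rw [Literature.Algebra.Polynomial.Descartes.even_signVariations_iff (by rw [hg0]; exact hc₀), hlead, hg0, mul_comm]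
    exact not_lt.mpr hends.le
  rcases Nat.even_or_odd g.signVariations with h | h
  · exact absurd h hodd
  · obtain ⟨k, hk⟩ := h
    omega

/-! ## 2. `Z₊ ≤ 5` for rank-one `(2,3)₁` pencils -/

/-- **Two letters below, one above** (`d₀ < d₁ < e < d₂`): if the letter above the pivot is CORE (`c₃ = w₂·m(J,v₂) < 0`) and the pair
coefficients are `≥ 0`, the seven-nomial has at most FIVE positive roots: its ends are `w₀w₁Δ₀₁² ≥ 0` (degree `d₀+d₁`) and `c₃ < 0`
(degree `e+d₂`) — if the former vanishes there are six terms, otherwise `Var` is odd. -/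
theorem sevenNomial_le_five_twoOne (e d₀ d₁ d₂ : ℕ) (h01 : d₀ < d₁) (h1e : d₁ < e) (he2 : e < d₂)
    (cv : Fin 7 → ℝ) (h3 : cv 3 < 0) (h4 : 0 ≤ cv 4) :
    ((∑ i : Fin 7, Polynomial.C (cv i) * X ^ ((![2 * e, e + d₀, e + d₁, e + d₂, d₀ + d₁, d₀ + d₂, d₁ + d₂] : Fin 7 → ℕ) i)).roots.toFinset.filter (fun t => 0 < t)).card ≤ 5 := by
  classical
  refine (Census.card_posRoots_le_signVariations _).trans ?_
  rcases h4.lt_or_eq with h4p | h4z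
  · exact signVariations_sevenNomial_le_five cv _ 4 3
      (fun i hi => by fin_cases i <;> simp at hi ⊢ <;> omega)
      (fun i hi => by fin_cases i <;> simp at hi ⊢ <;> omega)
      (by simpa using mul_neg_of_pos_of_neg h4p h3)
  · -- the lowest term vanishes: at most six monomials
    set f := (∑ i : Fin 7, Polynomial.C (cv i) * X ^ ((![2 * e, e + d₀, e + d₁, e + d₂, d₀ + d₁, d₀ + d₂, d₁ + d₂] : Fin 7 → ℕ) i)) with hf
    by_cases hf0 : f = 0
    · rw [hf0, signVariations_zero]; omega
    have h1 := Literature.Computability.AlgebraicComplexity.signVariations_lt_card_support hf0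
    have h2 : f.support.card ≤ 6 := by
      have hsub : f.support ⊆ ((Finset.univ : Finset (Fin 7)).erase 4).image
          (fun i => (![2 * e, e + d₀, e + d₁, e + d₂, d₀ + d₁, d₀ + d₂, d₁ + d₂] : Fin 7 → ℕ) i) := by
        intro m hm
        rw [Polynomial.mem_support_iff, hf, coeff_sevenNomial] at hm
        obtain ⟨i, _, hi⟩ := Finset.exists_ne_zero_of_sum_ne_zero hm
        refine Finset.mem_image.mpr ⟨i, Finset.mem_erase.mpr ⟨fun h => ?_, Finset.mem_univ _⟩, ?_⟩
        · rw [h, ← h4z] at hi; exact hi (by split_ifs <;> rfl)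
        · by_contra hne
          exact hi (if_neg (fun h => hne h.symm))
      refine (Finset.card_le_card hsub).trans (Finset.card_image_le.trans ?_)
      rw [Finset.card_erase_of_mem (Finset.mem_univ _)]; simp
    omega

/-- **One letter below, two above** (`d₀ < e < d₁ < d₂`): if the letter below the pivot is CORE (`c₁ = w₀·m(J,v₀) < 0`) and the pair
coefficients are `≥ 0`, at most FIVE positive roots (ends `c₁ < 0` at `e+d₀` and `w₁w₂Δ₁₂² ≥ 0` at `d₁+d₂`). -/
theorem sevenNomial_le_five_oneTwo (e d₀ d₁ d₂ : ℕ) (h0e : d₀ < e) (he1 : e < d₁) (h12 : d₁ < d₂)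
    (cv : Fin 7 → ℝ) (h1 : cv 1 < 0) (h6 : 0 ≤ cv 6) :
    ((∑ i : Fin 7, Polynomial.C (cv i) * X ^ ((![2 * e, e + d₀, e + d₁, e + d₂, d₀ + d₁, d₀ + d₂, d₁ + d₂] : Fin 7 → ℕ) i)).roots.toFinset.filter (fun t => 0 < t)).card ≤ 5 := by
  classical
  refine (Census.card_posRoots_le_signVariations _).trans ?_
  rcases h6.lt_or_eq with h6p | h6z
  · exact signVariations_sevenNomial_le_five cv _ 1 6
      (fun i hi => by fin_cases i <;> simp at hi ⊢ <;> omega)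
      (fun i hi => by fin_cases i <;> simp at hi ⊢ <;> omega)
      (by simpa using mul_neg_of_neg_of_pos h1 h6p)
  · set f := (∑ i : Fin 7, Polynomial.C (cv i) * X ^ ((![2 * e, e + d₀, e + d₁, e + d₂, d₀ + d₁, d₀ + d₂, d₁ + d₂] : Fin 7 → ℕ) i)) with hf
    by_cases hf0 : f = 0
    · rw [hf0, signVariations_zero]; omega
    have h1' := Literature.Computability.AlgebraicComplexity.signVariations_lt_card_support hf0
    have h2 : f.support.card ≤ 6 := by
      have hsub : f.support ⊆ ((Finset.univ : Finset (Fin 7)).erase 6).image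
          (fun i => (![2 * e, e + d₀, e + d₁, e + d₂, d₀ + d₁, d₀ + d₂, d₁ + d₂] : Fin 7 → ℕ) i) := by
        intro m hm
        rw [Polynomial.mem_support_iff, hf, coeff_sevenNomial] at hm
        obtain ⟨i, _, hi⟩ := Finset.exists_ne_zero_of_sum_ne_zero hm
        refine Finset.mem_image.mpr ⟨i, Finset.mem_erase.mpr ⟨fun h => ?_, Finset.mem_univ _⟩, ?_⟩
        · rw [h, ← h6z] at hi; exact hi (by split_ifs <;> rfl)
        · by_contra hne
          exact hi (if_neg (fun h => hne h.symm))
      refine (Finset.card_le_card hsub).trans (Finset.card_image_le.trans ?_)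
      rw [Finset.card_erase_of_mem (Finset.mem_univ _)]; simp
    omega

/-- **RANK-ONE `(2,3)₁`, TWO BELOW / ONE ABOVE: `Z₊ ≤ 5`** (matrix form).  `F = X^e J + ∑ₖ wₖ X^{dₖ} vₖvₖᵀ`, `d₀ < d₁ < e < d₂`, `wₖ ≥ 0`
(`w₂ > 0`), `J` ANY real `2 × 2` matrix, the above-pivot letter core (`m(J,v₂) < 0`): at most five distinct positive roots — one fewer
than the row's value `6` for rank-two letters. [this file] -/
theorem rankOne_posRoots_le_five_twoOne (e d₀ d₁ d₂ : ℕ) (h01 : d₀ < d₁) (h1e : d₁ < e) (he2 : e < d₂)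
    (J : Matrix (Fin 2) (Fin 2) ℝ) (v₀ v₁ v₂ : Fin 2 → ℝ) (w₀ w₁ w₂ : ℝ) (hw₀ : 0 ≤ w₀) (hw₁ : 0 ≤ w₁) (hw₂ : 0 < w₂)
    (hm₂ : J 0 0 * v₂ 1 ^ 2 + J 1 1 * v₂ 0 ^ 2 - (J 0 1 + J 1 0) * (v₂ 0 * v₂ 1) < 0) :
    ((Matrix.det (((X : ℝ[X]) ^ e) • J.map Polynomial.C
        + (Polynomial.C w₀ * X ^ d₀) • (vecMulVec v₀ v₀).map Polynomial.C
        + (Polynomial.C w₁ * X ^ d₁) • (vecMulVec v₁ v₁).map Polynomial.C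
        + (Polynomial.C w₂ * X ^ d₂) • (vecMulVec v₂ v₂).map Polynomial.C)).roots.toFinset.filter (fun t => 0 < t)).card
      ≤ 5 := by
  rw [det_rankOne_three_sum]
  exact sevenNomial_le_five_twoOne e d₀ d₁ d₂ h01 h1e he2 _ (by simpa using mul_neg_of_pos_of_neg hw₂ hm₂)
    (by simp only [Fin.isValue, Matrix.cons_val]; positivity)

/-- **RANK-ONE `(2,3)₁`, ONE BELOW / TWO ABOVE: `Z₊ ≤ 5`** (matrix form; `d₀ < e < d₁ < d₂`, the below-pivot letter core). [this file] -/
theorem rankOne_posRoots_le_five_oneTwo (e d₀ d₁ d₂ : ℕ) (h0e : d₀ < e) (he1 : e < d₁) (h12 : d₁ < d₂)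
    (J : Matrix (Fin 2) (Fin 2) ℝ) (v₀ v₁ v₂ : Fin 2 → ℝ) (w₀ w₁ w₂ : ℝ) (hw₀ : 0 < w₀) (hw₁ : 0 ≤ w₁) (hw₂ : 0 ≤ w₂)
    (hm₀ : J 0 0 * v₀ 1 ^ 2 + J 1 1 * v₀ 0 ^ 2 - (J 0 1 + J 1 0) * (v₀ 0 * v₀ 1) < 0) :
    ((Matrix.det (((X : ℝ[X]) ^ e) • J.map Polynomial.C
        + (Polynomial.C w₀ * X ^ d₀) • (vecMulVec v₀ v₀).map Polynomial.C
        + (Polynomial.C w₁ * X ^ d₁) • (vecMulVec v₁ v₁).map Polynomial.C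
        + (Polynomial.C w₂ * X ^ d₂) • (vecMulVec v₂ v₂).map Polynomial.C)).roots.toFinset.filter (fun t => 0 < t)).card
      ≤ 5 := by
  rw [det_rankOne_three_sum]
  exact sevenNomial_le_five_oneTwo e d₀ d₁ d₂ h0e he1 h12 _ (by simpa using mul_neg_of_pos_of_neg hw₀ hm₀)
    (by simp only [Fin.isValue, Matrix.cons_val]; positivity)

/-! ## 3. An exact object with FIVE positive roots (three rank-one core letters) -/

/-- Closed form of `det F(t)` for the object: pivot `[[0,10⁶],[10⁶,0]]` at exponent `3`, letters `(1,1)(1,1)ᵀ`, `130·(1,7)(1,7)ᵀ`,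
`60·(1,22000)(1,22000)ᵀ` at exponents `0, 2, 5` (the resonance `3 + 2 = 0 + 5` merges two terms into a positive one): a six-nomial. -/
theorem eval_det5 (t : ℝ) :
    (t ^ 3 • ((!![(0 : ℝ), 1000000; 1000000, 0] : Matrix (Fin 2) (Fin 2) ℝ)) + ∑ k, t ^ (![0, 2, 5] : Fin 3 → ℕ) k • ((![!![(1 : ℝ), 1; 1, 1], !![(130 : ℝ), 910; 910, 6370], !![(60 : ℝ), 1320000; 1320000, 29040000000]] : Fin 3 → Matrix (Fin 2) (Fin 2) ℝ)) k).det
      = 4680 * t ^ 2 - 2000000 * t ^ 3 + 27217360060 * t ^ 5 - 1000000000000 * t ^ 6 + 3772797982200 * t ^ 7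
        - 2640000000000 * t ^ 8 := by
  rw [Matrix.det_fin_two]
  simp [Matrix.add_apply, Fin.sum_univ_succ]
  ring

/-- The exponents `2 < 3 < 5 < 6 < 7 < 8` are strictly increasing. -/
theorem strictMono_exponents5 : StrictMono (![2, 3, 5, 6, 7, 8] : Fin 6 → ℕ) := by
  refine Fin.strictMono_iff_lt_succ.2 fun j => ?_
  fin_cases j <;> decide

/-- The six integer coefficients are non-zero. -/
theorem coeff_ne_zero5 : ∀ k : Fin 6,
    (![4680, -2000000, 27217360060, -1000000000000, 3772797982200, -2640000000000] : Fin 6 → ℤ) k ≠ 0 := by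
  intro k; fin_cases k <;> decide

/-- The determinant of the object as an integer fewnomial. -/
theorem det_eq_fewnomial5 :
    Matrix.det (((X : ℝ[X]) ^ 3) • ((!![(0 : ℝ), 1000000; 1000000, 0] : Matrix (Fin 2) (Fin 2) ℝ)).map Polynomial.C + ∑ k, ((X : ℝ[X]) ^ (![0, 2, 5] : Fin 3 → ℕ) k) • (((![!![(1 : ℝ), 1; 1, 1], !![(130 : ℝ), 910; 910, 6370], !![(60 : ℝ), 1320000; 1320000, 29040000000]] : Fin 3 → Matrix (Fin 2) (Fin 2) ℝ)) k).map Polynomial.C)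
      = ∑ k : Fin 6, Polynomial.C
          ((((![4680, -2000000, 27217360060, -1000000000000, 3772797982200, -2640000000000] : Fin 6 → ℤ) k : ℤ) : ℝ))
          * Polynomial.X ^ ((![2, 3, 5, 6, 7, 8] : Fin 6 → ℕ) k) := by
  apply Polynomial.funext
  intro t
  rw [eval_det_pivot, eval_det5, Polynomial.eval_finsetSum]
  simp only [Polynomial.eval_mul, Polynomial.eval_C, Polynomial.eval_pow, Polynomial.eval_X, Fin.sum_univ_succ,
    Fin.sum_univ_zero]
  simp
  ring

/-- **Descartes count `V = 5`** (sign word `+ − + − + −`). -/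
theorem signVariations_det5 :
    (Matrix.det (((X : ℝ[X]) ^ 3) • ((!![(0 : ℝ), 1000000; 1000000, 0] : Matrix (Fin 2) (Fin 2) ℝ)).map Polynomial.C + ∑ k, ((X : ℝ[X]) ^ (![0, 2, 5] : Fin 3 → ℕ) k) • (((![!![(1 : ℝ), 1; 1, 1], !![(130 : ℝ), 910; 910, 6370], !![(60 : ℝ), 1320000; 1320000, 29040000000]] : Fin 3 → Matrix (Fin 2) (Fin 2) ℝ)) k).map Polynomial.C)).signVariations
      = 5 := by
  rw [det_eq_fewnomial5, Census.signVariations_fin_rsum_int _ _ strictMono_exponents5 _ coeff_ne_zero5]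
  decide +kernel

/-- `Z₊ ≤ 5` for the object by Descartes. -/
theorem object_pivotPosRoots_le_five : pivotPosRoots 3 (![0, 2, 5] : Fin 3 → ℕ) ((!![(0 : ℝ), 1000000; 1000000, 0] : Matrix (Fin 2) (Fin 2) ℝ)) ((![!![(1 : ℝ), 1; 1, 1], !![(130 : ℝ), 910; 910, 6370], !![(60 : ℝ), 1320000; 1320000, 29040000000]] : Fin 3 → Matrix (Fin 2) (Fin 2) ℝ)) ≤ 5 := by
  unfold pivotPosRoots
  calc _ ≤ _ := Census.card_posRoots_le_signVariations _
    _ = 5 := signVariations_det5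

/-- `Z₊ ≥ 5`: `det F` alternates `+ − + − + −` at `t = 1/1000, 1/200, 1/50, 1/10, 1/2, 2`. -/
theorem five_le_object_pivotPosRoots : 5 ≤ pivotPosRoots 3 (![0, 2, 5] : Fin 3 → ℕ) ((!![(0 : ℝ), 1000000; 1000000, 0] : Matrix (Fin 2) (Fin 2) ℝ)) ((![!![(1 : ℝ), 1; 1, 1], !![(130 : ℝ), 910; 910, 6370], !![(60 : ℝ), 1320000; 1320000, 29040000000]] : Fin 3 → Matrix (Fin 2) (Fin 2) ℝ)) :=
  le_pivotPosRoots_of_certificate (N := 5) eval_det5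
    ![1 / 1000, 1 / 200, 1 / 50, 1 / 10, 1 / 2, 2]
    (by
      refine Fin.strictMono_iff_lt_succ.2 fun j => ?_
      fin_cases j <;> simp only [Fin.castSucc_mk, Fin.succ_mk] <;> norm_num)
    (by intro j; fin_cases j <;> norm_num)
    (by intro j; fin_cases j <;> simp only [Fin.castSucc_mk, Fin.succ_mk] <;> norm_num)

/-- **EXACTLY FIVE positive roots** for the rank-one `(2,3)₁` object. -/
theorem object_pivotPosRoots_eq_five : pivotPosRoots 3 (![0, 2, 5] : Fin 3 → ℕ) ((!![(0 : ℝ), 1000000; 1000000, 0] : Matrix (Fin 2) (Fin 2) ℝ)) ((![!![(1 : ℝ), 1; 1, 1], !![(130 : ℝ), 910; 910, 6370], !![(60 : ℝ), 1320000; 1320000, 29040000000]] : Fin 3 → Matrix (Fin 2) (Fin 2) ℝ)) = 5 :=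
  le_antisymm object_pivotPosRoots_le_five five_le_object_pivotPosRoots

/-- The object's letters are rank one: `Pₖ = cₖ · vₖvₖᵀ`, `c = (1, 130, 60)`, `v = (1,1), (1,7), (1,22000)`. -/
theorem letters_eq5 (k : Fin 3) :
    ((![!![(1 : ℝ), 1; 1, 1], !![(130 : ℝ), 910; 910, 6370], !![(60 : ℝ), 1320000; 1320000, 29040000000]] : Fin 3 → Matrix (Fin 2) (Fin 2) ℝ)) k = (![(1 : ℝ), 130, 60] : Fin 3 → ℝ) k
        • vecMulVec ((![![(1 : ℝ), 1], ![(1 : ℝ), 7], ![(1 : ℝ), 22000]] : Fin 3 → Fin 2 → ℝ) k)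
          ((![![(1 : ℝ), 1], ![(1 : ℝ), 7], ![(1 : ℝ), 22000]] : Fin 3 → Fin 2 → ℝ) k) := by
  ext i j
  fin_cases k <;> fin_cases i <;> fin_cases j <;> simp <;> norm_num

/-- The object's pivot is symmetric, indefinite and of index one (`J + W Wᵀ = 10⁶ · I` for `W = (1000, −1000)ᵀ`), and all three
letters are core (`m(J,vₖ) = −2·10⁶·vₖ₀vₖ₁ < 0`). -/
theorem object_hardCell :
    ((!![(0 : ℝ), 1000000; 1000000, 0] : Matrix (Fin 2) (Fin 2) ℝ)).IsSymm ∧ ((!![(0 : ℝ), 1000000; 1000000, 0] : Matrix (Fin 2) (Fin 2) ℝ)).det < 0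
      ∧ (((!![(0 : ℝ), 1000000; 1000000, 0] : Matrix (Fin 2) (Fin 2) ℝ)) + (!![(1000 : ℝ); -1000] : Matrix (Fin 2) (Fin 1) ℝ) * (!![(1000 : ℝ); -1000] : Matrix (Fin 2) (Fin 1) ℝ)ᵀ).PosSemidef
      ∧ ∀ k : Fin 3, ((!![(0 : ℝ), 1000000; 1000000, 0] : Matrix (Fin 2) (Fin 2) ℝ)) 0 0 * (((![![(1 : ℝ), 1], ![(1 : ℝ), 7], ![(1 : ℝ), 22000]] : Fin 3 → Fin 2 → ℝ) k) 1) ^ 2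
          + ((!![(0 : ℝ), 1000000; 1000000, 0] : Matrix (Fin 2) (Fin 2) ℝ)) 1 1 * (((![![(1 : ℝ), 1], ![(1 : ℝ), 7], ![(1 : ℝ), 22000]] : Fin 3 → Fin 2 → ℝ) k) 0) ^ 2
          - (((!![(0 : ℝ), 1000000; 1000000, 0] : Matrix (Fin 2) (Fin 2) ℝ)) 0 1 + ((!![(0 : ℝ), 1000000; 1000000, 0] : Matrix (Fin 2) (Fin 2) ℝ)) 1 0) * ((((![![(1 : ℝ), 1], ![(1 : ℝ), 7], ![(1 : ℝ), 22000]] : Fin 3 → Fin 2 → ℝ) k) 0)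
            * (((![![(1 : ℝ), 1], ![(1 : ℝ), 7], ![(1 : ℝ), 22000]] : Fin 3 → Fin 2 → ℝ) k) 1)) < 0 := by
  refine ⟨by unfold Matrix.IsSymm; ext i j; fin_cases i <;> fin_cases j <;> rfl, by rw [Matrix.det_fin_two]; simp, ?_, ?_⟩
  · have h : (((!![(0 : ℝ), 1000000; 1000000, 0] : Matrix (Fin 2) (Fin 2) ℝ)) + (!![(1000 : ℝ); -1000] : Matrix (Fin 2) (Fin 1) ℝ) * (!![(1000 : ℝ); -1000] : Matrix (Fin 2) (Fin 1) ℝ)ᵀ)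
        = (1000000 : ℝ) • (1 : Matrix (Fin 2) (Fin 2) ℝ) := by
      ext i j
      fin_cases i <;> fin_cases j <;>
        (simp [Matrix.transpose_apply, Matrix.vecHead, Matrix.vecTail]; try norm_num)
    rw [h]
    exact Matrix.PosSemidef.one.smul (by norm_num)
  · intro k; fin_cases k <;> simp

/-- **THE RANK-ONE `(2,3)₁` CELL ATTAINS `5`** (packaged): an index-one `2 × 2` pivot pencil with three rank-one CORE letters (two below,
one above the pivot) and EXACTLY five distinct positive determinant roots.  With `rankOne_posRoots_le_five_twoOne` / `…_oneTwo` this is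
the exact value of the rank-one sub-row at `K = 3`: FIVE (general letters: six, `…PivotTwoThree`). [this file] -/
theorem exists_rankOne_three_five :
    ∃ (e : ℕ) (d : Fin 3 → ℕ) (J : Matrix (Fin 2) (Fin 2) ℝ) (c : Fin 3 → ℝ) (v : Fin 3 → Fin 2 → ℝ),
      J.IsSymm ∧ J.det < 0 ∧ (∃ W : Matrix (Fin 2) (Fin 1) ℝ, (J + W * Wᵀ).PosSemidef) ∧ (∀ k, 0 < c k)
      ∧ (d 0 < d 1 ∧ d 1 < e ∧ e < d 2)
      ∧ (∀ k, J 0 0 * (v k 1) ^ 2 + J 1 1 * (v k 0) ^ 2 - (J 0 1 + J 1 0) * (v k 0 * v k 1) < 0)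
      ∧ pivotPosRoots e d J (fun k => c k • vecMulVec (v k) (v k)) = 5 := by
  obtain ⟨h1, h2, h3, h4⟩ := object_hardCell
  refine ⟨3, (![0, 2, 5] : Fin 3 → ℕ), ((!![(0 : ℝ), 1000000; 1000000, 0] : Matrix (Fin 2) (Fin 2) ℝ)), ![(1 : ℝ), 130, 60], ![![(1 : ℝ), 1], ![(1 : ℝ), 7], ![(1 : ℝ), 22000]], h1, h2, ⟨_, h3⟩, ?_,
    by simp, h4, ?_⟩
  · intro k; fin_cases k <;> norm_num
  · have h : (fun k => (![(1 : ℝ), 130, 60] : Fin 3 → ℝ) k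
        • vecMulVec ((![![(1 : ℝ), 1], ![(1 : ℝ), 7], ![(1 : ℝ), 22000]] : Fin 3 → Fin 2 → ℝ) k)
          ((![![(1 : ℝ), 1], ![(1 : ℝ), 7], ![(1 : ℝ), 22000]] : Fin 3 → Fin 2 → ℝ) k)) = ((![!![(1 : ℝ), 1; 1, 1], !![(130 : ℝ), 910; 910, 6370], !![(60 : ℝ), 1320000; 1320000, 29040000000]] : Fin 3 → Matrix (Fin 2) (Fin 2) ℝ)) := by
      funext k; rw [letters_eq5]
    rw [h]
    exact object_pivotPosRoots_eq_five

end Summit.ValiantsHypothesis.ValiantsHypothesis.Theorems.LacunarySymmetroidMatrixDescartes.Pivot.RankOneThree
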